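import Summits.Ventures.PackingBounds.Energy.FivePointRieszThreeDefs
import HarnessLib

/-!
# `FivePointRieszThree`: the value of the bound `5(4c - F(1,1,1) - a₁) = 1/4 + 3√2 + 2/3√3`

Framing: lottery ticket; floor = certified bounds/negative ranges. Venture `PackingBounds`, cell
`pub-packcert`, energy family E3PT (pub-packcert-energy gen 12; KERNEL-D6 data route).
-/

noncomputable section

namespace Summit.Ventures.PackingBounds.Energy.FivePointRieszThree

set_option maxRecDepth 20000 in
set_option maxHeartbeats 400000000 in
/-- The value of the bound: `5(4c - F(1,1,1) - a₁) = 1/4 + 3√2 + 2/3√3` (the bipyramid's energy over ordered pairs). -/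
theorem bound_eqR3 : (5 : ℝ) * ((5 - 1) * c0KR3 - FexpKR3 1 1 1 - a1KR3 * 1) = (((1 : ℝ)/4) + (3 : ℝ) * s2R3 + ((2 : ℝ)/3) * s3R3) := by
  unfold c0KR3 FexpKR3 a1KR3; ring

end Summit.Ventures.PackingBounds.Energy.FivePointRieszThree
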